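import Mathlib
import Summits.QuantumFields.YangMills.Theorems.BalabanUVNodesN15BackgroundLayerEntriesOfLetters
import HarnessLib

/-!
# Route «BalabanUVNodes» (cluster K4 «SpineRates»), Track-A DAG node N15 = spine estimate NE2, BACKGROUND LAYER — THE AVERAGING WORDS OF (3.60):
# `F₂*aQ + Q*aF₂ + F₂*aF₂` as ONE block-local perturbation of the stacked `U ≡ 1` layer, with the block mean `Q` CONCRETE (its two-spacing intertwining
# EXACT under uniform pairing fibres) and `F₂`, `F₂*` abstract block-local operators with two letters; the three letters of the FULL perturbation `V̂₁ − W∘pr_none`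

Cell `pub-ymgap`, seat `pub-ymgap-dag-n15-c` (generation g4; R134 ACCELERATION SEAT, strategy s1 «background-layer OPERATOR ingredient»; HUMAN RULING D-0062; chair
R424 venue).  `bears_on: R4∕N15`.  Filed `--supports stmt-QuantumFields-19908 --as helper` (K3′; helper).  Imports BY NAME, nothing in the tree modified: this seat's V0
`…N15BackgroundLayerEntriesOfLetters` (through it n15-b's B1b `projO`, `blkPair`, `liftPair`; `T4EtaRateCoeffDefect.pull`∕`diagK`∕`fibre`∕`hasMaj_pull`∕`hasMaj_mulOp`,
`T4EtaRateDefect.idef`∕`idef_comp`∕`idef_add`∕`idef_sub`, `B11SectG.hasMaj_comp`, `B6Prop26Gluing.mulOp`, n15-b's `sum_diagK_mul`, `kappa_ofBlocks`).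

WHY.  Every background-layer readout in the tree (n15-b B4∕C2, this seat's M3∕G2∕V2∕B1 (V4)) dresses the `U ≡ 1` layer by the FIRST-ORDER perturbation `V′₁(A)` of
[Balaban1985BackgroundPropagators] (3.52) p. 400 only; the print's full perturbation is (3.60) p. 402: «Δ_{U′U} + Q′*(U′U)aQ′(U′U) = Δ_U + Q′*(U)aQ′(U) − V′₁(A) +
F′₂*(A)aQ′(U) + Q′*(U)aF′₂(A) + F′₂*(A)aF′₂(A) = Δ_U + Q′*(U)aQ′(U) − V′(A)», where `F′₂ⱼ(A)` is the block-local perturbation of the averaging operator ((3.58)–(3.59):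
«|F′₂ⱼ(A; y, x)| ≤ O(1)α₁», «|(F′₂ⱼ(A)λ)(y)| ≤ O(1)α₁(Q′ⱼ|λ|)(y)») and `F′₂*` its starred companion («not an adjoint of F′₂ⱼ(A)»).  The three AVERAGING WORDS contain
no difference operator: they act on `λ` itself (the `none` component of the stack), block-locally.  THIS FILE types them in the lineage's frame — `Q = fibAvg q` the
CONCRETE fibrewise block mean over a blocking `q : X → Y` nested in the majorant blocks (`blk = blkY ∘ q`), `Q* = pull q`, `a : Y → ℝ` the (3.24) weight, and `F₂ :
(X → ℝ) →ₗ (Y → ℝ)`, `F₂* : (Y → ℝ) →ₗ (X → ℝ)` ABSTRACT with the sup letter `diagK r` — and proves the one new fact the η-RATE needs: under UNIFORM fibres of the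
pairing `π : X′ → X` (`#π⁻¹x = N ≥ 1`; King's pairing has them, `DefectKernel.card_fibre_kingProj`) the averaging pair intertwines EXACTLY, `fibAvg (q∘π) ∘ pull π =
fibAvg q` and `pull π ∘ pull q = pull (q∘π)`, so the two-spacing defect of the words through `(pull π, pull π)` is carried by the fit letters `diagK o` of `F₂`, `F₂*`
ALONE (Leibniz); the full perturbation `V̂ = V̂₁ − W∘pr_none` then has B1a's three letters by additivity, and V0's `hasMaj_entries_of_letters` applies verbatim (sequel).

CONTENTS ([folklore] bookkeeping + one lattice identity; 2 defs).
* §0 `hasMaj_add_diagK`, `hasMaj_sub_diagK`, `hasMaj_comp_diagK` (algebra of constant diagonal majorants through sharp block norms).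
* §1 `fibAvg q` (`fibAvg_apply`, `abs_fibAvg_le`), **`hasMaj_fibAvg`** (`Q ≤ diagK 1` when `blk = blkY ∘ q`).
* §2 `sum_fibre_comp`, `card_fibre_comp`, **`fibAvg_comp_pull`** (`Q′∘τ = Q` under uniform fibres), `fibAvg_pull_apply`, `idef_fibAvg_eq_zero`, `idef_pull_eq_zero`.
* §3 `avgWord q a F Fs := Fs∘(M_a∘Q) + Q*∘(M_a∘F) + Fs∘(M_a∘F)`; **`hasMaj_avgWord`** (`≤ diagK (â·r·(2 + r))`); `idef_avgWord_eq` (Leibniz with the `Q`-defects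
  zero); **`hasMaj_idef_avgWord`** (`𝔇(W′, W) ≤ diagK (â·o·(2 + 2r))`).
* §4 On the stack: `hasMaj_comp_projO`, `idef_comp_projO`, `hasMaj_idef_comp_projO`; **`hasMaj_sub_word`**, **`hasMaj_idef_sub_word`** (the letters of `V̂₁ − W∘pr_none`).
* §5 A model inhabitant of the `F`-letters: `F := Q∘M`, `F* := M∘Q*` for any block-local `M` — **`hasMaj_fibAvg_comp`**, **`hasMaj_idef_fibAvg_comp`** (letters = `M`'s).

HONEST FRAMING ∕ LIMITS.  SHAPES of (3.60) in the `U ≡ 1` background; `Q` is the (3.19)-type PLAIN block mean at `U ≡ 1` (no parallel transport; NOT the (1.18) line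
average of 1-forms); `F₂`, `F₂*` and their two letters are DISPLAYED — the print's construction (3.55)–(3.58) of `F′₂ⱼ(A)` is NOT typed here (the Literature cell's
one-spacing `B9Eq358KeyEstimate`∕`B9Eq360VprimeLetters.avgOp` live on a different carrier and are not consumed), and the fit letter `o` is NOT PRINTED (NE2⁺ is not);
nothing about Bałaban's `G(U)` asserted.  NE2⁺ NOT PRINTED, NOT proved; count-neutral (typed 28∕28; nothing discharged); N15 NOT discharged; one finite lattice at
fixed ε — NOT infinite volume, NOT OS on ℝ⁴, NOT a mass gap, NOT Clay.
-/

noncomputable section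

open scoped BigOperators

namespace Summit.QuantumFields.YangMills.BalabanUVNodes.N15.BackgroundLayer

open Literature.MathematicalPhysics.QuantumFieldTheory.Balaban1983to89
open Literature.MathematicalPhysics.QuantumFieldTheory.Balaban1983to89.B11SectG (BlockNorm HasMaj hasMaj_comp)
open Literature.MathematicalPhysics.QuantumFieldTheory.Balaban1983to89.T4EtaRateDefect (idef idef_apply idef_comp idef_add idef_sub)
open Literature.MathematicalPhysics.QuantumFieldTheory.Balaban1983to89.T4EtaRateCoeffDefect (pull pull_apply pull_comp_pull diagK diagK_same diagK_ne
  diagK_nonneg diagK_mono fibre mem_fibre hasMaj_pull hasMaj_mulOp)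
open Literature.MathematicalPhysics.QuantumFieldTheory.Balaban1983to89.B11AxialTransport190 (abs_le_loc_ofBlocks loc_ofBlocks_le)
open Literature.MathematicalPhysics.QuantumFieldTheory.Balaban1983to89.B6Prop26Gluing (mulOp mulOp_apply)
open Summit.QuantumFields.YangMills.BalabanUVNodes.N15.DerivDefect (sum_diagK_mul)
open Summit.QuantumFields.YangMills.BalabanUVNodes.N15.BackgroundModel (kappa_ofBlocks)

/-! ## §0 Algebra of constant diagonal majorants -/

section DiagK

variable {g : B6.Geometry} {F₁ F₂ F₃ : Type} [AddCommGroup F₁] [Module ℝ F₁] [AddCommGroup F₂] [Module ℝ F₂] [AddCommGroup F₃] [Module ℝ F₃]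

/-- Constant diagonal majorants ADD. [folklore] -/
theorem hasMaj_add_diagK {b₁ : BlockNorm g F₁} {b₂ : BlockNorm g F₂} {T₁ T₂ : F₁ →ₗ[ℝ] F₂} {o₁ o₂ : ℝ}
    (h₁ : HasMaj b₁ b₂ T₁ (diagK fun _ => o₁)) (h₂ : HasMaj b₁ b₂ T₂ (diagK fun _ => o₂)) :
    HasMaj b₁ b₂ (T₁ + T₂) (diagK fun _ => o₁ + o₂) :=
  (h₁.add h₂).mono fun a b => by
    by_cases hab : a = b
    · subst hab; simp [diagK_same]
    · simp [diagK_ne _ hab]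

/-- … and majorise DIFFERENCES. [folklore] -/
theorem hasMaj_sub_diagK {b₁ : BlockNorm g F₁} {b₂ : BlockNorm g F₂} {T₁ T₂ : F₁ →ₗ[ℝ] F₂} {o₁ o₂ : ℝ}
    (h₁ : HasMaj b₁ b₂ T₁ (diagK fun _ => o₁)) (h₂ : HasMaj b₁ b₂ T₂ (diagK fun _ => o₂)) :
    HasMaj b₁ b₂ (T₁ - T₂) (diagK fun _ => o₁ + o₂) :=
  (h₁.sub h₂).mono fun a b => by
    by_cases hab : a = b
    · subst hab; simp [diagK_same]
    · simp [diagK_ne _ hab]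

/-- Constant diagonal majorants COMPOSE through a sharp-block middle space (`κ = 1`): `diagK o₁ ∘ diagK o₂ = diagK (o₁o₂)`. [folklore] -/
theorem hasMaj_comp_diagK {X₂ : Type} [Fintype X₂] (blk₂ : X₂ → g.Site) {b₁ : BlockNorm g F₁} {b₃ : BlockNorm g F₃}
    {T₁ : (X₂ → ℝ) →ₗ[ℝ] F₃} {T₂ : F₁ →ₗ[ℝ] (X₂ → ℝ)} {o₁ o₂ : ℝ} (ho₁ : 0 ≤ o₁)
    (h₁ : HasMaj (BlockNorm.ofBlocks g blk₂) b₃ T₁ (diagK fun _ => o₁)) (h₂ : HasMaj b₁ (BlockNorm.ofBlocks g blk₂) T₂ (diagK fun _ => o₂)) :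
    HasMaj b₁ b₃ (T₁ ∘ₗ T₂) (diagK fun _ => o₁ * o₂) := by
  refine (hasMaj_comp h₁ h₂ fun _ _ => diagK_nonneg (fun _ => ho₁) _ _).mono fun a b => le_of_eq ?_
  rw [kappa_ofBlocks]
  simp only [one_mul]
  rw [sum_diagK_mul]
  by_cases hab : a = b
  · subst hab; simp [diagK_same]
  · simp [diagK_ne _ hab]

end DiagK

/-! ## §1 The fibrewise block mean `Q` and its majorant -/

section Avg

variable {X Y : Type} [Fintype X] [DecidableEq Y]

/-- THE BLOCK MEAN over the fibres of a blocking `q : X → Y`: `(Qf)(y) = |q⁻¹y|⁻¹ Σ_{x ∈ q⁻¹y} f(x)` (junk `0` over an empty fibre) — the `U ≡ 1` reading of the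
averaging operator (3.19) «(Q′ⱼ(U)λ)(y) = Σ_{x∈Bʲ(y)} L^{−jd} R(U(Γ_{y,x}))λ(x)» as a linear map. [cite: Balaban1985BackgroundPropagators, (3.19) p.393 (shape, at U ≡ 1)] -/
def fibAvg (q : X → Y) : (X → ℝ) →ₗ[ℝ] (Y → ℝ) where
  toFun f y := (∑ x ∈ fibre q y, f x) / (fibre q y).card
  map_add' f f' := funext fun y => by simp only [Pi.add_apply, Finset.sum_add_distrib, add_div]
  map_smul' c f := funext fun y => by simp only [Pi.smul_apply, smul_eq_mul, RingHom.id_apply, ← Finset.mul_sum, mul_div_assoc]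

/-- Unfolding. [folklore] -/
@[simp] theorem fibAvg_apply (q : X → Y) (f : X → ℝ) (y : Y) : fibAvg q f y = (∑ x ∈ fibre q y, f x) / (fibre q y).card := rfl

/-- A mean is bounded by a common bound of the averaged values (`a ≥ 0`). [folklore] -/
theorem abs_fibAvg_le (q : X → Y) {f : X → ℝ} {y : Y} {a : ℝ} (ha : 0 ≤ a) (h : ∀ x, q x = y → |f x| ≤ a) : |fibAvg q f y| ≤ a := by
  rw [fibAvg_apply]
  rcases Nat.eq_zero_or_pos (fibre q y).card with h0 | hpos
  · rw [h0, Nat.cast_zero, div_zero, abs_zero]; exact ha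
  · have hc : (0 : ℝ) < (fibre q y).card := by exact_mod_cast hpos
    rw [abs_div, abs_of_pos hc, div_le_iff₀ hc]
    calc |∑ x ∈ fibre q y, f x| ≤ ∑ x ∈ fibre q y, |f x| := Finset.abs_sum_le_sum_abs _ _
      _ ≤ ∑ _x ∈ fibre q y, a := Finset.sum_le_sum fun x hx => h x ((mem_fibre q y x).1 hx)
      _ = a * (fibre q y).card := by rw [Finset.sum_const, nsmul_eq_mul, mul_comm]

variable [Fintype Y] {g : B6.Geometry}

/-- **`Q ≤ diagK 1`**: when the averaging blocks nest in the majorant blocks (`blk = blkY ∘ q`), the block mean is a contraction between the sharp block norms, cube by cube.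
[cite: Balaban1985BackgroundPropagators, (3.19) p.393 (the normalisation `Σ_x L^{−jd} = 1`: shape)] -/
theorem hasMaj_fibAvg (blk : X → g.Site) (blkY : Y → g.Site) (q : X → Y) (hq : ∀ x, blk x = blkY (q x)) :
    HasMaj (BlockNorm.ofBlocks g blk) (BlockNorm.ofBlocks g blkY) (fibAvg q) (diagK fun _ => 1) := by
  intro y' μ hμ y
  have hμ' : ∀ x, blk x ≠ y' → μ x = 0 := hμ
  by_cases hy : y = y'
  · subst hy
    simp only [diagK_same, one_mul]
    refine loc_ofBlocks_le blkY _ ((BlockNorm.ofBlocks g blk).loc_nonneg _ _) fun yy hyy => ?_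
    exact abs_fibAvg_le q ((BlockNorm.ofBlocks g blk).loc_nonneg _ _) fun x hx => abs_le_loc_ofBlocks blk μ (by rw [hq x, hx, hyy])
  · rw [diagK_ne _ hy, zero_mul]
    refine loc_ofBlocks_le blkY _ le_rfl fun yy hyy => ?_
    refine abs_fibAvg_le q le_rfl fun x hx => ?_
    rw [hμ' x (by rw [hq x, hx, hyy]; exact hy), abs_zero]

end Avg

/-! ## §2 Two spacings: the averaging pair intertwines EXACTLY under uniform pairing fibres -/

section Pair

variable {X X' Y : Type} [Fintype X] [Fintype X'] [DecidableEq X] [DecidableEq Y]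

/-- The fibre of `q ∘ π` over `y` is fibred over the fibre of `q`: `Σ_{x′ : q(πx′) = y} g(x′) = Σ_{x : qx = y} Σ_{x′ : πx′ = x} g(x′)`. [folklore] -/
theorem sum_fibre_comp (q : X → Y) (π : X' → X) (G : X' → ℝ) (y : Y) :
    ∑ x' ∈ fibre (q ∘ π) y, G x' = ∑ x ∈ fibre q y, ∑ x' ∈ fibre π x, G x' := by
  have hmaps : ∀ x' ∈ fibre (q ∘ π) y, π x' ∈ fibre q y := fun x' hx' =>
    (mem_fibre q y (π x')).2 ((mem_fibre (q ∘ π) y x').1 hx')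
  rw [← Finset.sum_fiberwise_of_maps_to hmaps]
  refine Finset.sum_congr rfl fun x hx => Finset.sum_congr ?_ fun _ _ => rfl
  ext x'
  simp only [Finset.mem_filter, mem_fibre, Function.comp_apply]
  constructor
  · rintro ⟨_, h⟩; exact h
  · intro h; exact ⟨by rw [h]; exact (mem_fibre q y x).1 hx, h⟩

/-- … hence `#(q∘π)⁻¹y = Σ_{x ∈ q⁻¹y} #π⁻¹x`. [folklore] -/
theorem card_fibre_comp (q : X → Y) (π : X' → X) (y : Y) : (fibre (q ∘ π) y).card = ∑ x ∈ fibre q y, (fibre π x).card := by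
  have h := sum_fibre_comp q π (fun _ => (1 : ℝ)) y
  simp only [Finset.sum_const, nsmul_eq_mul, mul_one] at h
  exact_mod_cast h

/-- **THE AVERAGING OPERATOR INTERTWINES THE PULL-BACK EXACTLY**: if every fibre of the pairing `π : X′ → X` has the same size `N ≥ 1`, then the fine block mean of a
pulled-back function IS the coarse block mean — `Q′ ∘ τ = Q` (the blocks `Y` are common to both spacings). [cite: King1986, p.664 (pairing convention «x′ ∈ B^n(x)»: uniform fibres)] -/
theorem fibAvg_comp_pull (q : X → Y) (π : X' → X) {N : ℕ} (hN : N ≠ 0) (hfib : ∀ x, (fibre π x).card = N) :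
    fibAvg (q ∘ π) ∘ₗ pull π = fibAvg q := by
  refine LinearMap.ext fun f => funext fun y => ?_
  rw [LinearMap.comp_apply, fibAvg_apply, fibAvg_apply]
  have hsum : ∑ x' ∈ fibre (q ∘ π) y, pull π f x' = N * ∑ x ∈ fibre q y, f x := by
    rw [sum_fibre_comp, Finset.mul_sum]
    refine Finset.sum_congr rfl fun x _ => ?_
    have hin : ∀ x' ∈ fibre π x, pull π f x' = f x := fun x' hx' => by rw [pull_apply, (mem_fibre π x x').1 hx']
    rw [Finset.sum_congr rfl hin, Finset.sum_const, hfib x, nsmul_eq_mul]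
  have hcard : (fibre (q ∘ π) y).card = N * (fibre q y).card := by
    rw [card_fibre_comp, Finset.sum_congr rfl (fun x _ => hfib x), Finset.sum_const, smul_eq_mul, mul_comm]
  rw [hsum, hcard, Nat.cast_mul, mul_div_mul_left _ _ (Nat.cast_ne_zero.2 hN)]

/-- Applied form of `fibAvg_comp_pull`. [folklore] -/
theorem fibAvg_pull_apply (q : X → Y) (π : X' → X) {N : ℕ} (hN : N ≠ 0) (hfib : ∀ x, (fibre π x).card = N) (f : X → ℝ) :
    fibAvg (q ∘ π) (pull π f) = fibAvg q f :=
  LinearMap.congr_fun (fibAvg_comp_pull q π hN hfib) f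

/-- **ZERO DEFECT OF `Q`**: `𝔇_{(τ, 1)}(Q′, Q) = Q′τ − Q = 0` under uniform fibres. [folklore] -/
theorem idef_fibAvg_eq_zero (q : X → Y) (π : X' → X) {N : ℕ} (hN : N ≠ 0) (hfib : ∀ x, (fibre π x).card = N) :
    idef (pull π) LinearMap.id (fibAvg (q ∘ π)) (fibAvg q) = 0 := by
  show fibAvg (q ∘ π) ∘ₗ pull π - LinearMap.id ∘ₗ fibAvg q = 0
  rw [fibAvg_comp_pull q π hN hfib, LinearMap.id_comp, sub_self]

omit [Fintype X] [Fintype X'] [DecidableEq X] [DecidableEq Y] in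
/-- **ZERO DEFECT OF `Q*`**: `𝔇_{(1, τ)}(Q′*, Q*) = Q′* − τQ* = 0` (pull-backs compose; no hypothesis). [folklore] -/
theorem idef_pull_eq_zero (q : X → Y) (π : X' → X) : idef LinearMap.id (pull π) (pull (q ∘ π)) (pull q) = 0 := by
  show pull (q ∘ π) ∘ₗ LinearMap.id - pull π ∘ₗ pull q = 0
  rw [LinearMap.comp_id, pull_comp_pull, sub_self]

end Pair

/-! ## §3 The averaging words `F₂*aQ + Q*aF₂ + F₂*aF₂`, their majorant and their two-spacing defect -/

section Words

variable {X X' Y : Type} [Fintype X] [Fintype X'] [Fintype Y] [DecidableEq X] [DecidableEq Y] {g : B6.Geometry}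

/-- THE AVERAGING WORDS OF (3.60): `W = F₂*∘(M_a∘Q) + Q*∘(M_a∘F₂) + F₂*∘(M_a∘F₂)` for the block mean `Q = fibAvg q`, `Q* = pull q`, the (3.24) weight `a : Y → ℝ`, and
block-local operators `F₂ : (X → ℝ) → (Y → ℝ)`, `F₂* : (Y → ℝ) → (X → ℝ)` (so that `V′ = V′₁ − W`). [cite: Balaban1985BackgroundPropagators, (3.60) p.402 («F′₂*(A)aQ′(U) + Q′*(U)aF′₂(A) + F′₂*(A)aF′₂(A)»: shape)] -/
def avgWord (q : X → Y) (a : Y → ℝ) (F : (X → ℝ) →ₗ[ℝ] (Y → ℝ)) (Fs : (Y → ℝ) →ₗ[ℝ] (X → ℝ)) : (X → ℝ) →ₗ[ℝ] (X → ℝ) :=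
  Fs ∘ₗ (mulOp a ∘ₗ fibAvg q) + pull q ∘ₗ (mulOp a ∘ₗ F) + Fs ∘ₗ (mulOp a ∘ₗ F)

omit [DecidableEq X] in
/-- **THE WORDS ARE BLOCK-LOCAL OF SIZE `â·r·(2 + r)`**: from `blk = blkY ∘ q`, `|a| ≤ â`, `F₂ ≤ diagK r`, `F₂* ≤ diagK r` (`â, r ≥ 0`).
[cite: Balaban1985BackgroundPropagators, (3.59) p.402 + (3.61) p.402 (shapes: the starred terms of the (3.61) bound)] -/
theorem hasMaj_avgWord (blk : X → g.Site) (blkY : Y → g.Site) (q : X → Y) (hq : ∀ x, blk x = blkY (q x)) {a : Y → ℝ} {â r : ℝ}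
    (hâ : 0 ≤ â) (hr : 0 ≤ r) (ha : ∀ y, |a y| ≤ â) {F : (X → ℝ) →ₗ[ℝ] (Y → ℝ)} {Fs : (Y → ℝ) →ₗ[ℝ] (X → ℝ)}
    (hF : HasMaj (BlockNorm.ofBlocks g blk) (BlockNorm.ofBlocks g blkY) F (diagK fun _ => r))
    (hFs : HasMaj (BlockNorm.ofBlocks g blkY) (BlockNorm.ofBlocks g blk) Fs (diagK fun _ => r)) :
    HasMaj (BlockNorm.ofBlocks g blk) (BlockNorm.ofBlocks g blk) (avgWord q a F Fs) (diagK fun _ => â * r * (2 + r)) := by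
  have hblk : blk = blkY ∘ q := funext hq
  subst hblk
  have hQ := hasMaj_fibAvg (g := g) (blkY ∘ q) blkY q fun _ => rfl
  have hQs : HasMaj (BlockNorm.ofBlocks g blkY) (BlockNorm.ofBlocks g (blkY ∘ q)) (pull q) (diagK fun _ => 1) := hasMaj_pull blkY q
  have hA : HasMaj (BlockNorm.ofBlocks g blkY) (BlockNorm.ofBlocks g blkY) (mulOp a) (diagK fun _ => â) := hasMaj_mulOp blkY (fun _ => hâ) ha
  have h1 := hasMaj_comp_diagK blkY hr hFs (hasMaj_comp_diagK blkY hâ hA hQ)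
  have h2 := hasMaj_comp_diagK blkY zero_le_one hQs (hasMaj_comp_diagK blkY hâ hA hF)
  have h3 := hasMaj_comp_diagK blkY hr hFs (hasMaj_comp_diagK blkY hâ hA hF)
  refine (hasMaj_add_diagK (hasMaj_add_diagK h1 h2) h3).mono fun y y' => diagK_mono (fun _ => le_of_eq ?_) y y'
  ring

variable (q : X → Y) (π : X' → X) (a : Y → ℝ) (F : (X → ℝ) →ₗ[ℝ] (Y → ℝ)) (Fs : (Y → ℝ) →ₗ[ℝ] (X → ℝ)) (F' : (X' → ℝ) →ₗ[ℝ] (Y → ℝ))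
  (Fs' : (Y → ℝ) →ₗ[ℝ] (X' → ℝ))

omit [Fintype Y] in
/-- LEIBNIZ WITH THE `Q`-DEFECTS ZERO: through `(pull π, pull π)` the two-spacing defect of the words is
`𝔇(F₂*′,F₂*)∘(M_a∘Q) + Q′*∘(M_a∘𝔇(F₂′,F₂)) + [F₂*′∘(M_a∘𝔇(F₂′,F₂)) + 𝔇(F₂*′,F₂*)∘(M_a∘F₂)]` (uniform fibres; `𝔇(F₂′,F₂) = F₂′τ − F₂`, `𝔇(F₂*′,F₂*) = F₂*′ − τF₂*`). [folklore] -/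
theorem idef_avgWord_eq {N : ℕ} (hN : N ≠ 0) (hfib : ∀ x, (fibre π x).card = N) :
    idef (pull π) (pull π) (avgWord (q ∘ π) a F' Fs') (avgWord q a F Fs) =
      idef LinearMap.id (pull π) Fs' Fs ∘ₗ (mulOp a ∘ₗ fibAvg q) +
        pull (q ∘ π) ∘ₗ (mulOp a ∘ₗ idef (pull π) LinearMap.id F' F) +
        (Fs' ∘ₗ (mulOp a ∘ₗ idef (pull π) LinearMap.id F' F) + idef LinearMap.id (pull π) Fs' Fs ∘ₗ (mulOp a ∘ₗ F)) := by
  refine LinearMap.ext fun f => ?_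
  have hQ : fibAvg (q ∘ π) (pull π f) = fibAvg q f := fibAvg_pull_apply q π hN hfib f
  have hQs : ∀ u : Y → ℝ, pull π (pull q u) = pull (q ∘ π) u := fun u => rfl
  simp only [avgWord, idef_apply, LinearMap.add_apply, LinearMap.comp_apply, LinearMap.id_apply, map_add, map_sub, hQ, hQs]
  abel

/-- **THE TWO-SPACING DEFECT OF THE WORDS IS CARRIED BY THE `F`-LETTERS ALONE**: with uniform pairing fibres, `|a| ≤ â`, the sup letters `F₂′, F₂*′ ≤ diagK r` and the
fit letters `𝔇(F₂′, F₂) ≤ diagK o` (through `(pull π, 1)`), `𝔇(F₂*′, F₂*) ≤ diagK o` (through `(1, pull π)`): `𝔇(W′, W) ≤ diagK (â·o·(2 + 2r))` through `(pull π, pull π)`.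
NOT PRINTED (the η-rate is not); the mechanism of (3.63)–(3.65). [cite: Balaban1985BackgroundPropagators, (3.60) p.402 (shape); (3.63)–(3.65) pp.402–403 (mechanism)] -/
theorem hasMaj_idef_avgWord (blk : X → g.Site) (blkY : Y → g.Site) (hq : ∀ x, blk x = blkY (q x)) {N : ℕ} (hN : N ≠ 0)
    (hfib : ∀ x, (fibre π x).card = N) {â r o : ℝ} (hâ : 0 ≤ â) (hr : 0 ≤ r) (ho : 0 ≤ o) (ha : ∀ y, |a y| ≤ â)
    (hF : HasMaj (BlockNorm.ofBlocks g blk) (BlockNorm.ofBlocks g blkY) F (diagK fun _ => r))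
    (hF' : HasMaj (BlockNorm.ofBlocks g (blk ∘ π)) (BlockNorm.ofBlocks g blkY) F' (diagK fun _ => r))
    (hFs' : HasMaj (BlockNorm.ofBlocks g blkY) (BlockNorm.ofBlocks g (blk ∘ π)) Fs' (diagK fun _ => r))
    (hDF : HasMaj (BlockNorm.ofBlocks g blk) (BlockNorm.ofBlocks g blkY) (idef (pull π) LinearMap.id F' F) (diagK fun _ => o))
    (hDFs : HasMaj (BlockNorm.ofBlocks g blkY) (BlockNorm.ofBlocks g (blk ∘ π)) (idef LinearMap.id (pull π) Fs' Fs) (diagK fun _ => o)) :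
    HasMaj (BlockNorm.ofBlocks g blk) (BlockNorm.ofBlocks g (blk ∘ π))
      (idef (pull π) (pull π) (avgWord (q ∘ π) a F' Fs') (avgWord q a F Fs)) (diagK fun _ => â * o * (2 + 2 * r)) := by
  have hblk : blk = blkY ∘ q := funext hq
  subst hblk
  have hQ := hasMaj_fibAvg (g := g) (blkY ∘ q) blkY q fun _ => rfl
  have hQs' : HasMaj (BlockNorm.ofBlocks g blkY) (BlockNorm.ofBlocks g ((blkY ∘ q) ∘ π)) (pull (q ∘ π)) (diagK fun _ => 1) :=
    hasMaj_pull blkY (q ∘ π)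
  have hA : HasMaj (BlockNorm.ofBlocks g blkY) (BlockNorm.ofBlocks g blkY) (mulOp a) (diagK fun _ => â) := hasMaj_mulOp blkY (fun _ => hâ) ha
  have h1 := hasMaj_comp_diagK blkY ho hDFs (hasMaj_comp_diagK blkY hâ hA hQ)
  have h2 := hasMaj_comp_diagK blkY zero_le_one hQs' (hasMaj_comp_diagK blkY hâ hA hDF)
  have h3 := hasMaj_comp_diagK blkY hr hFs' (hasMaj_comp_diagK blkY hâ hA hDF)
  have h4 := hasMaj_comp_diagK blkY ho hDFs (hasMaj_comp_diagK blkY hâ hA hF)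
  rw [idef_avgWord_eq q π a F Fs F' Fs' hN hfib]
  refine (hasMaj_add_diagK (hasMaj_add_diagK h1 h2) (hasMaj_add_diagK h3 h4)).mono fun y y' => diagK_mono (fun _ => le_of_eq ?_) y y'
  ring

end Words

/-! ## §4 On the stack: the three letters of the full perturbation `V̂₁ − W∘pr_none` -/

section Stack

variable {X X' J : Type} [Fintype X] [Fintype X'] [Fintype J] {g : B6.Geometry} (blk : X → g.Site) (π : X' → X)

/-- A block-local `W ≤ diagK r` read on a component of the stack stays `≤ diagK r` (`pr_j ≤ diagK 1`). [folklore] -/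
theorem hasMaj_comp_projO {W : (X → ℝ) →ₗ[ℝ] (X → ℝ)} {r : ℝ} (hr : 0 ≤ r)
    (hW : HasMaj (BlockNorm.ofBlocks g blk) (BlockNorm.ofBlocks g blk) W (diagK fun _ => r)) (j : Option J) :
    HasMaj (BlockNorm.ofBlocks g (blkPair blk)) (BlockNorm.ofBlocks g blk) (W ∘ₗ projO j) (diagK fun _ => r) := by
  have hP : HasMaj (BlockNorm.ofBlocks g (blkPair (J := J) blk)) (BlockNorm.ofBlocks g blk) (projO j) (diagK fun _ => 1) :=
    hasMaj_pull (blkPair blk) (fun x => (x, j))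
  exact (hasMaj_comp_diagK blk hr hW hP).mono fun y y' => diagK_mono (fun _ => (mul_one r).le) y y'

omit [Fintype X] [Fintype X'] [Fintype J] in
/-- The defect of `W∘pr_j` through `(pull (liftPair π), pull π)` is the defect of `W` read on the component: `𝔇(W′∘pr_j, W∘pr_j) = 𝔇(W′, W)∘pr_j` (by `rfl` pointwise). [folklore] -/
theorem idef_comp_projO (W' : (X' → ℝ) →ₗ[ℝ] (X' → ℝ)) (W : (X → ℝ) →ₗ[ℝ] (X → ℝ)) (j : Option J) :
    idef (pull (liftPair π)) (pull π) (W' ∘ₗ projO j) (W ∘ₗ projO j) = idef (pull π) (pull π) W' W ∘ₗ projO j :=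
  LinearMap.ext fun _ => rfl

/-- … so a fit letter `𝔇(W′, W) ≤ diagK o` passes to the component. [folklore] -/
theorem hasMaj_idef_comp_projO {W : (X → ℝ) →ₗ[ℝ] (X → ℝ)} {W' : (X' → ℝ) →ₗ[ℝ] (X' → ℝ)} {o : ℝ} (ho : 0 ≤ o)
    (hDW : HasMaj (BlockNorm.ofBlocks g blk) (BlockNorm.ofBlocks g (blk ∘ π)) (idef (pull π) (pull π) W' W) (diagK fun _ => o)) (j : Option J) :
    HasMaj (BlockNorm.ofBlocks g (blkPair blk)) (BlockNorm.ofBlocks g (blk ∘ π))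
      (idef (pull (liftPair π)) (pull π) (W' ∘ₗ projO j) (W ∘ₗ projO j)) (diagK fun _ => o) := by
  rw [idef_comp_projO]
  have hP : HasMaj (BlockNorm.ofBlocks g (blkPair (J := J) blk)) (BlockNorm.ofBlocks g blk) (projO j) (diagK fun _ => 1) :=
    hasMaj_pull (blkPair blk) (fun x => (x, j))
  exact (hasMaj_comp_diagK blk ho hDW hP).mono fun y y' => diagK_mono (fun _ => (mul_one o).le) y y'

/-- **LETTERS 1–2 OF THE FULL PERTURBATION**: `V̂₁ ≤ diagK R` and `W ≤ diagK r` give `V̂₁ − W∘pr_none ≤ diagK (R + r)` (either spacing).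
[cite: Balaban1985BackgroundPropagators, (3.60)–(3.61) p.402 (shape: «V′(A) is defined by the last equality. It satisfies the bound …»)] -/
theorem hasMaj_sub_word {V : (X × Option J → ℝ) →ₗ[ℝ] (X → ℝ)} {W : (X → ℝ) →ₗ[ℝ] (X → ℝ)} {R r : ℝ} (hr : 0 ≤ r)
    (hV : HasMaj (BlockNorm.ofBlocks g (blkPair blk)) (BlockNorm.ofBlocks g blk) V (diagK fun _ => R))
    (hW : HasMaj (BlockNorm.ofBlocks g blk) (BlockNorm.ofBlocks g blk) W (diagK fun _ => r)) :
    HasMaj (BlockNorm.ofBlocks g (blkPair blk)) (BlockNorm.ofBlocks g blk) (V - W ∘ₗ projO none) (diagK fun _ => R + r) :=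
  hasMaj_sub_diagK hV (hasMaj_comp_projO blk hr hW none)

/-- **LETTER 3 OF THE FULL PERTURBATION**: `𝔇(V̂₁′, V̂₁) ≤ diagK O` (through `(pull (liftPair π), pull π)`) and `𝔇(W′, W) ≤ diagK o` (through `(pull π, pull π)`) give
`𝔇(V̂₁′ − W′∘pr_none, V̂₁ − W∘pr_none) ≤ diagK (O + o)`. [cite: Balaban1985BackgroundPropagators, (3.60) p.402 (shape); (3.63)–(3.65) pp.402–403 (mechanism)] -/
theorem hasMaj_idef_sub_word {V : (X × Option J → ℝ) →ₗ[ℝ] (X → ℝ)} {V' : (X' × Option J → ℝ) →ₗ[ℝ] (X' → ℝ)} {W : (X → ℝ) →ₗ[ℝ] (X → ℝ)}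
    {W' : (X' → ℝ) →ₗ[ℝ] (X' → ℝ)} {O o : ℝ} (ho : 0 ≤ o)
    (hDV : HasMaj (BlockNorm.ofBlocks g (blkPair blk)) (BlockNorm.ofBlocks g (blk ∘ π)) (idef (pull (liftPair π)) (pull π) V' V) (diagK fun _ => O))
    (hDW : HasMaj (BlockNorm.ofBlocks g blk) (BlockNorm.ofBlocks g (blk ∘ π)) (idef (pull π) (pull π) W' W) (diagK fun _ => o)) :
    HasMaj (BlockNorm.ofBlocks g (blkPair blk)) (BlockNorm.ofBlocks g (blk ∘ π))
      (idef (pull (liftPair π)) (pull π) (V' - W' ∘ₗ projO none) (V - W ∘ₗ projO none)) (diagK fun _ => O + o) := by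
  rw [idef_sub]
  exact hasMaj_sub_diagK hDV (hasMaj_idef_comp_projO blk π ho hDW none)

end Stack

/-! ## §5 A model inhabitant of the `F`-letters: the block mean of a block-local multiplier -/

section Model

variable {X X' Y : Type} [Fintype X] [Fintype X'] [Fintype Y] [DecidableEq X] [DecidableEq Y] {g : B6.Geometry}
  (blk : X → g.Site) (blkY : Y → g.Site) (q : X → Y) (π : X' → X)

omit [Fintype X'] [DecidableEq X] in
/-- THE SUP LETTERS OF THE MODEL SPECIES `F₂ := Q∘M`, `F₂* := M∘Q*` for ANY block-local `M ≤ diagK r`: both `≤ diagK r`. [folklore] -/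
theorem hasMaj_fibAvg_comp (hq : ∀ x, blk x = blkY (q x)) {M : (X → ℝ) →ₗ[ℝ] (X → ℝ)} {r : ℝ} (hr : 0 ≤ r)
    (hM : HasMaj (BlockNorm.ofBlocks g blk) (BlockNorm.ofBlocks g blk) M (diagK fun _ => r)) :
    HasMaj (BlockNorm.ofBlocks g blk) (BlockNorm.ofBlocks g blkY) (fibAvg q ∘ₗ M) (diagK fun _ => r) ∧
      HasMaj (BlockNorm.ofBlocks g blkY) (BlockNorm.ofBlocks g blk) (M ∘ₗ pull q) (diagK fun _ => r) := by
  have hblk : blk = blkY ∘ q := funext hq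
  subst hblk
  have hQ := hasMaj_fibAvg (g := g) (blkY ∘ q) blkY q fun _ => rfl
  have hQs : HasMaj (BlockNorm.ofBlocks g blkY) (BlockNorm.ofBlocks g (blkY ∘ q)) (pull q) (diagK fun _ => 1) := hasMaj_pull blkY q
  exact ⟨(hasMaj_comp_diagK (blkY ∘ q) zero_le_one hQ hM).mono fun y y' => diagK_mono (fun _ => (one_mul r).le) y y',
    (hasMaj_comp_diagK (blkY ∘ q) hr hM hQs).mono fun y y' => diagK_mono (fun _ => (mul_one r).le) y y'⟩

/-- THE FIT LETTERS OF THE MODEL SPECIES: under uniform pairing fibres, `𝔇(Q′∘M′, Q∘M) = Q′∘𝔇(M′, M)` and `𝔇(M′∘Q′*, M∘Q*) = 𝔇(M′, M)∘Q*`, so a fit letter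
`𝔇(M′, M) ≤ diagK o` of the multiplier IS the fit letter of both. [folklore] -/
theorem hasMaj_idef_fibAvg_comp (hq : ∀ x, blk x = blkY (q x)) {N : ℕ} (hN : N ≠ 0) (hfib : ∀ x, (fibre π x).card = N)
    {M : (X → ℝ) →ₗ[ℝ] (X → ℝ)} {M' : (X' → ℝ) →ₗ[ℝ] (X' → ℝ)} {o : ℝ} (ho : 0 ≤ o)
    (hDM : HasMaj (BlockNorm.ofBlocks g blk) (BlockNorm.ofBlocks g (blk ∘ π)) (idef (pull π) (pull π) M' M) (diagK fun _ => o)) :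
    HasMaj (BlockNorm.ofBlocks g blk) (BlockNorm.ofBlocks g blkY) (idef (pull π) LinearMap.id (fibAvg (q ∘ π) ∘ₗ M') (fibAvg q ∘ₗ M)) (diagK fun _ => o) ∧
      HasMaj (BlockNorm.ofBlocks g blkY) (BlockNorm.ofBlocks g (blk ∘ π)) (idef LinearMap.id (pull π) (M' ∘ₗ pull (q ∘ π)) (M ∘ₗ pull q))
        (diagK fun _ => o) := by
  have hblk : blk = blkY ∘ q := funext hq
  subst hblk
  have hQ' := hasMaj_fibAvg (g := g) ((blkY ∘ q) ∘ π) blkY (q ∘ π) fun _ => rfl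
  have hQs : HasMaj (BlockNorm.ofBlocks g blkY) (BlockNorm.ofBlocks g (blkY ∘ q)) (pull q) (diagK fun _ => 1) := hasMaj_pull blkY q
  have e1 : idef (pull π) LinearMap.id (fibAvg (q ∘ π) ∘ₗ M') (fibAvg q ∘ₗ M) = fibAvg (q ∘ π) ∘ₗ idef (pull π) (pull π) M' M := by
    rw [idef_comp (pull π) (pull π) LinearMap.id, idef_fibAvg_eq_zero q π hN hfib, LinearMap.zero_comp, add_zero]
  have e2 : idef LinearMap.id (pull π) (M' ∘ₗ pull (q ∘ π)) (M ∘ₗ pull q) = idef (pull π) (pull π) M' M ∘ₗ pull q := by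
    rw [idef_comp LinearMap.id (pull π) (pull π), idef_pull_eq_zero q π, LinearMap.comp_zero, zero_add]
  rw [e1, e2]
  exact ⟨(hasMaj_comp_diagK ((blkY ∘ q) ∘ π) zero_le_one hQ' hDM).mono fun y y' => diagK_mono (fun _ => (one_mul o).le) y y',
    (hasMaj_comp_diagK (blkY ∘ q) ho hDM hQs).mono fun y y' => diagK_mono (fun _ => (mul_one o).le) y y'⟩

end Model

end Summit.QuantumFields.YangMills.BalabanUVNodes.N15.BackgroundLayer

end
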